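import Summits.AtomisticToContinuum.BoseEinsteinCondensation.Theorems.BECSwapNoCatastropheTorusHalfSwapOverlapUpperFrameHardCoreCutoff
import Summits.AtomisticToContinuum.BoseEinsteinCondensation.Theorems.BECSwapNoCatastropheTorusHalfSwapOverlapUpperFrameHardCoreSupport
import HarnessLib

/-!
# Crux `TorusHalfSwapOverlap` (stmt-AtomisticToContinuum-14393), line `birth`, stub `stub_upperFrameHardCore` (S7),
# part C1: pointwise bounds, the cut-off test function, no cross interaction

Route `BECSwapNoCatastrophe` (sub-problem `BoseEinsteinCondensation`), lead c6 (2026-08-17). Third of four files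
proving the HARD-CORE UPPER FRAME `inf_{Adm0} E2(½) ≤ 2 E₀^per(n+1, L) + C n L⁻³`. With the cut-off calculus of part A
(`…UpperFrameHardCoreCutoff.lean`) and the hard-core support / packing / averaging kernel of part B
(`…UpperFrameHardCoreSupport.lean`):

* smoothness and two-copy periodicity of the cross cut-off `φ(X, Y) = (∏ⱼ f(x₀ - yⱼ₊₁)) ∏ⱼ f(y₀ - xⱼ₊₁)` for a `C¹`
  periodic factor `f`; an image within `R` kills the periodic factor of `f₀(y) = θ((|y| - R)/a)`, no image within the
  range kills the periodised potential;
* homogeneity `E2(½)(cΘ) = |c|² E2(½)(Θ)` and the test of the `Adm0`-infimum by an unnormalised function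
  (`iInf_le_inv_mul`);
* NO CROSS INTERACTION on `Θ sin(cφ)`: `E2(½)(Θ sin(cφ)) ≤ E2(0)(Θ sin(cφ))` (`E2half_le_E2zero_of_cut`, the registered
  helper stub `stub_upperFrameHardCorePointwise`);
* the POINTWISE BOUNDS of the IMS error density `|Θ_t|² (|∇ sin(πφ/2)|² + |∇ cos(πφ/2)|²)` and of the mass deficit density
  `|Θ_t cos(πφ/2)|²` by `W |Θ_t|²`, `W = ∑ⱼ (G(x₀ - yⱼ₊₁) + G(y₀ - xⱼ₊₁))`, `G = c₁ |∇f|² + (1 - f²)`, for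
  `Θ_t = Ψ(X) Ψ(Y - t𝟙)` with `Ψ` supported on `a`-separated configurations (gradient identity + pointwise gradient bound
  of part A fed with the packing count of part B; Jordan).

All folklore.
-/

noncomputable section

open MeasureTheory Filter
open scoped ENNReal NNReal BigOperators ComplexConjugate

namespace Summit.AtomisticToContinuum.BoseEinsteinCondensation.Cruxes.TorusHalfSwapOverlap.Birth

open Literature.MathematicalPhysics.QuantumManyBody.BoseGas

/-! ### Helper lemmas (inside `namespace UpperFrameHardCorePointwise … end UpperFrameHardCorePointwise`) -/

namespace UpperFrameHardCorePointwise

open Literature.Analysis.FunctionSpaces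
open UpperFrameHardCoreCutoff UpperFrameHardCoreSupport
open Summit.AtomisticToContinuum.BoseEinsteinCondensation.TwoCopyTorus
  (kinetic2 cell2 E2zero E2half E2half_eq Adm0 IsPeriodic2)

variable {n : ℕ} {L : ℝ}

/-! #### Smoothness and periodicity of the cross cut-off; the two vanishing facts -/

/-- The cross cut-off is `C¹` for a `C¹` factor. [folklore] -/
theorem contDiff_crossCutoff {f : Space → ℝ} (hf : ContDiff ℝ 1 f) :
    ContDiff ℝ 1 fun W : Config (n + 1) × Config (n + 1) =>
      (∏ j : Fin n, f (W.1 0 - W.2 j.succ)) * ∏ j : Fin n, f (W.2 0 - W.1 j.succ) := by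
  refine (contDiff_prod fun j _ => hf.comp ?_).mul (contDiff_prod fun j _ => hf.comp ?_)
  · exact ((contDiff_apply ℝ Space 0).comp contDiff_fst).sub ((contDiff_apply ℝ Space j.succ).comp contDiff_snd)
  · exact ((contDiff_apply ℝ Space 0).comp contDiff_snd).sub ((contDiff_apply ℝ Space j.succ).comp contDiff_fst)

/-- The cross cut-off is `Lℤ³`-periodic in every particle of either copy, for an `Lℤ³`-periodic factor.
[folklore] -/
theorem crossCutoff_periodic {f : Space → ℝ}
    (hper : ∀ (y : Space) (m : Fin 3 → ℤ), f (y + latticeVec L m) = f y)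
    (Z : Config (n + 1) × Config (n + 1)) (i : Fin (n + 1)) (k : Fin 3) :
    ((∏ j : Fin n, f ((Z.1 + Pi.single i (EuclideanSpace.single k L) : Config (n + 1)) 0 - Z.2 j.succ)) *
          ∏ j : Fin n, f (Z.2 0 - (Z.1 + Pi.single i (EuclideanSpace.single k L) : Config (n + 1)) j.succ) =
        (∏ j : Fin n, f (Z.1 0 - Z.2 j.succ)) * ∏ j : Fin n, f (Z.2 0 - Z.1 j.succ)) ∧
      ((∏ j : Fin n, f (Z.1 0 - (Z.2 + Pi.single i (EuclideanSpace.single k L) : Config (n + 1)) j.succ)) *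
          ∏ j : Fin n, f ((Z.2 + Pi.single i (EuclideanSpace.single k L) : Config (n + 1)) 0 - Z.1 j.succ) =
        (∏ j : Fin n, f (Z.1 0 - Z.2 j.succ)) * ∏ j : Fin n, f (Z.2 0 - Z.1 j.succ)) := by
  have hsub : ∀ (y : Space) (m : Fin 3 → ℤ), f (y - latticeVec L m) = f y := fun y m => by
    rw [sub_eq_add_neg, ← latticeVec_neg, hper]
  have key : ∀ (U V : Config (n + 1)),
      ((∏ j : Fin n, f ((U + Pi.single i (EuclideanSpace.single k L) : Config (n + 1)) 0 - V j.succ)) *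
          ∏ j : Fin n, f (V 0 - (U + Pi.single i (EuclideanSpace.single k L) : Config (n + 1)) j.succ)) =
        (∏ j : Fin n, f (U 0 - V j.succ)) * ∏ j : Fin n, f (V 0 - U j.succ) := by
    intro U V
    obtain ⟨m, hm⟩ := exists_apply_add_single U i k L 0
    simp_rw [hm, add_sub_right_comm, hper]
    congr 1
    refine Finset.prod_congr rfl fun j _ => ?_
    obtain ⟨m', hm'⟩ := exists_apply_add_single U i k L j.succ
    rw [hm', ← sub_sub, hsub]
  refine ⟨key Z.1 Z.2, ?_⟩
  rw [mul_comm, key Z.2 Z.1, mul_comm]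

/-- **An image within `R` kills the periodic cut-off factor**: for the profile `f₀(y) = θ((|y| - R)/a)` and
`2R < L`, if some lattice image of `y` has norm `≤ R` then `pairFactor L f₀ y = 0`. [folklore] -/
theorem pairFactor_eq_zero_of_norm_sub_le {a R L : ℝ} (ha : 0 < a) (hL : 0 < L) (hRL : 2 * R < L) {y : Space}
    {m : Fin 3 → ℤ} (hm : ‖y - latticeVec L m‖ ≤ R) :
    pairFactor L (fun z : Space => Torus.smoothCutProfile ((‖z‖ - R) / a)) y = 0 := by
  rw [pairFactor, reduce_eq_of_norm_lt hL (hm.trans_lt (by linarith))]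
  exact cut_eq_zero ha (by linarith)

/-- **No image within the range kills the periodised potential**: if `v = 0` beyond `R₀` and every lattice
image of `y` has norm `> R₀`, then `v^per(y) = 0`. [folklore] -/
theorem periodizedPotential_eq_zero_of_lt {v : ℝ → ℝ≥0∞} {R₀ : ℝ} (hv : ∀ r, R₀ < r → v r = 0) {L : ℝ} {y : Space}
    (h : ∀ m : Fin 3 → ℤ, R₀ < ‖y - latticeVec L m‖) : periodizedPotential v L y = 0 :=
  ENNReal.tsum_eq_zero.2 fun m => hv _ (h m)

/-! #### Homogeneity of `E2(½)` and the normalised test function -/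

/-- `E2(½)(c Θ) = |c|² E2(½)(Θ)` for a complex constant. [folklore] -/
theorem E2half_const_mul (v : ℝ → ℝ≥0∞) (n : ℕ) (L : ℝ) (c : ℂ) (Θ : Config (n + 1) × Config (n + 1) → ℂ) :
    E2half v n L (fun Z => c * Θ Z) = ((‖c‖₊ : ℝ≥0∞)) ^ 2 * E2half v n L Θ := by
  rw [E2half_eq, E2half_eq, ← lintegral_const_mul' _ _ (ENNReal.pow_ne_top ENNReal.coe_ne_top)]
  refine lintegral_congr fun Z => ?_
  simp only [TwoCopyTorus.kinetic2]
  rw [kineticDensity_const_mul_complex c (fun X => Θ (X, Z.2)) Z.1,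
    kineticDensity_const_mul_complex c (fun Y => Θ (Z.1, Y)) Z.2, ennnorm_mul_sq]
  ring

/-- **Testing the infimum with an unnormalised function**: for `C¹` `Θ₁` periodic in both copies with mass
`m₁ ∈ (0, ∞)` on `cell²`, `inf_{Adm0} E2(½) ≤ m₁⁻¹ E2(½)(Θ₁)` (rescale by `m₁^{-1/2}`). [folklore] -/
theorem iInf_le_inv_mul (v : ℝ → ℝ≥0∞) {Θ₁ : Config (n + 1) × Config (n + 1) → ℂ} (hC : ContDiff ℝ 1 Θ₁)
    (hper : IsPeriodic2 n L Θ₁) (hm0 : ∫⁻ Z in cell2 n L, ((‖Θ₁ Z‖₊ : ℝ≥0∞)) ^ 2 ≠ 0)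
    (hmt : ∫⁻ Z in cell2 n L, ((‖Θ₁ Z‖₊ : ℝ≥0∞)) ^ 2 ≠ ⊤) :
    (⨅ (Θ : Config (n + 1) × Config (n + 1) → ℂ) (_ : Adm0 n L Θ), E2half v n L Θ) ≤
      (∫⁻ Z in cell2 n L, ((‖Θ₁ Z‖₊ : ℝ≥0∞)) ^ 2)⁻¹ * E2half v n L Θ₁ := by
  -- the normalising constant, adapted from `ProductLower.periodicGroundStateEnergy_mul_normSq_le_of_periodic`
  set m := ∫⁻ Z in cell2 n L, ((‖Θ₁ Z‖₊ : ℝ≥0∞)) ^ 2 with hm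
  have hmpos : 0 < m.toReal := ENNReal.toReal_pos hm0 hmt
  obtain ⟨c, hc2⟩ : ∃ c : ℂ, ((‖c‖₊ : ℝ≥0∞)) ^ 2 = m⁻¹ :=
    ⟨((Real.sqrt m.toReal)⁻¹ : ℂ), by
      rw [coe_nnnorm_sq_eq_ofReal, norm_inv, Complex.norm_real,
        Real.norm_of_nonneg (Real.sqrt_nonneg _), inv_pow, Real.sq_sqrt hmpos.le,
        ENNReal.ofReal_inv_of_pos hmpos, ENNReal.ofReal_toReal hmt]⟩
  have hAdm : Adm0 n L fun Z => c * Θ₁ Z := by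
    refine ⟨contDiff_const.mul hC, fun Z i k => ?_, ?_⟩
    · dsimp only
      rw [(hper Z i k).1, (hper Z i k).2]
      exact ⟨rfl, rfl⟩
    · simp_rw [ennnorm_mul_sq]
      rw [lintegral_const_mul' _ _ (ENNReal.pow_ne_top ENNReal.coe_ne_top), hc2, ENNReal.inv_mul_cancel hm0 hmt]
  calc (⨅ (Θ : Config (n + 1) × Config (n + 1) → ℂ) (_ : Adm0 n L Θ), E2half v n L Θ)
      ≤ E2half v n L fun Z => c * Θ₁ Z := iInf₂_le _ hAdm
    _ = m⁻¹ * E2half v n L Θ₁ := by rw [E2half_const_mul, hc2]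

/-! #### The cross interaction vanishes on the cut-off test function -/

/-- **No cross interaction on the support of `J₁ = sin(cφ)`**: for the cross cut-off `φ` built from the periodic
factor `f` of `f₀(y) = θ((|y| - R)/a)` and a profile `v` vanishing beyond `R ≥ 0` (`2(R + 2a) < L`), every tagged
cross term `v^per(y₀ - xⱼ₊₁) |Θ J₁|²`, `v^per(x₀ - yⱼ₊₁) |Θ J₁|²` vanishes pointwise (an image within `R` kills the
factor `f`, hence `φ` and `J₁`; no image within `R` kills `v^per`), so `E2(½)(Θ J₁) ≤ E2(0)(Θ J₁)`. [folklore] -/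
theorem E2half_le_E2zero_of_cut {v : ℝ → ℝ≥0∞} (hvm : Measurable v) {a R : ℝ} (ha : 0 < a) (hR : 0 ≤ R)
    (hvR : ∀ r, R < r → v r = 0) (hL : 0 < L) (hbL : 2 * (R + 2 * a) < L)
    {Θ : Config (n + 1) × Config (n + 1) → ℂ} (hΘ : Continuous Θ) (c : ℝ) :
    E2half v n L (fun Z => Θ Z * (Real.sin (c *
        ((∏ j : Fin n, pairFactor L (fun y : Space => Torus.smoothCutProfile ((‖y‖ - R) / a)) (Z.1 0 - Z.2 j.succ)) *
          ∏ j : Fin n, pairFactor L (fun y : Space => Torus.smoothCutProfile ((‖y‖ - R) / a)) (Z.2 0 - Z.1 j.succ))) : ℂ)) ≤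
      E2zero v n L (fun Z => Θ Z * (Real.sin (c *
        ((∏ j : Fin n, pairFactor L (fun y : Space => Torus.smoothCutProfile ((‖y‖ - R) / a)) (Z.1 0 - Z.2 j.succ)) *
          ∏ j : Fin n, pairFactor L (fun y : Space => Torus.smoothCutProfile ((‖y‖ - R) / a)) (Z.2 0 - Z.1 j.succ))) : ℂ)) := by
  set f : Space → ℝ := pairFactor L (fun y : Space => Torus.smoothCutProfile ((‖y‖ - R) / a)) with hf
  have hfC : ContDiff ℝ 1 f := (isPairProfile_cut ha hR).contDiff_pairFactor hL hbL
  have hcont : Continuous fun Z : Config (n + 1) × Config (n + 1) => Θ Z * (Real.sin (c *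
      ((∏ j : Fin n, f (Z.1 0 - Z.2 j.succ)) * ∏ j : Fin n, f (Z.2 0 - Z.1 j.succ))) : ℂ) :=
    hΘ.mul (Complex.continuous_ofReal.comp (Real.continuous_sin.comp
      (continuous_const.mul (contDiff_crossCutoff hfC).continuous)))
  refine (UpperFrameIntegrable.E2half_le_E2zero_add hvm L hcont).trans (le_of_eq ?_)
  rw [(lintegral_congr fun Z => ?_).trans lintegral_zero, add_zero]
  -- the cross integrand vanishes at `Z`
  by_cases hex : ∃ j : Fin n, (∃ m : Fin 3 → ℤ, ‖Z.2 0 - Z.1 j.succ - latticeVec L m‖ ≤ R) ∨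
      ∃ m : Fin 3 → ℤ, ‖Z.1 0 - Z.2 j.succ - latticeVec L m‖ ≤ R
  · -- an image within `R`: the cut-off factor, hence `J₁`, vanishes
    obtain ⟨j, hj⟩ := hex
    have hφ0 : (∏ j : Fin n, f (Z.1 0 - Z.2 j.succ)) * ∏ j : Fin n, f (Z.2 0 - Z.1 j.succ) = 0 := by
      rcases hj with ⟨m, hm⟩ | ⟨m, hm⟩
      · exact mul_eq_zero_of_right _ (Finset.prod_eq_zero (Finset.mem_univ j)
          (pairFactor_eq_zero_of_norm_sub_le ha hL (by linarith) hm))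
      · exact mul_eq_zero_of_left (Finset.prod_eq_zero (Finset.mem_univ j)
          (pairFactor_eq_zero_of_norm_sub_le ha hL (by linarith) hm)) _
    simp only [hφ0, mul_zero, Real.sin_zero, Complex.ofReal_zero, nnnorm_zero, ENNReal.coe_zero,
      zero_pow two_ne_zero]
  · -- no image within `R`: the cross potentials vanish
    push Not at hex
    have h0 : ∀ j : Fin n, periodizedPotential v L (Z.2 0 - Z.1 j.succ) + periodizedPotential v L (Z.1 0 - Z.2 j.succ) = 0 :=
      fun j => by rw [periodizedPotential_eq_zero_of_lt hvR (hex j).1, periodizedPotential_eq_zero_of_lt hvR (hex j).2,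
        add_zero]
    simp only [h0, mul_zero, Finset.sum_const_zero, zero_mul]

/-! #### Pointwise bounds of the IMS error and of the mass deficit by the cross weight -/

/-- **The IMS error density is bounded by the cross weight**: with `f = pairFactor L f₀` (`f₀` a pair profile of
radius `b`, `2b < L`), the cross cut-off `φ` and `Θ_t = Ψ(X) Ψ(Y - t𝟙)` for a periodic trial state `Ψ` all of whose
non-vanishing configurations have `a`-separated images,
`|Θ_t|² (|∇ sin(cφ)|² + |∇ cos(cφ)|²) ≤ W · |Θ_t|²`, `W = ∑ⱼ (G(x₀ - yⱼ₊₁) + G(y₀ - xⱼ₊₁))`,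
`G = c² ((1 + 2b/a)³ + 1) |∇f|² + (1 - f²)` (gradient identity of the partition, the pointwise gradient bound of
part A with the packing count of part B: only `≤ (1 + 2b/a)³` bath particles have a non-zero gradient factor).
[folklore] -/
theorem normSq_mul_kinetic2_le
    (hPk : ∀ (a R : ℝ), 0 < a → 0 ≤ R → ∀ (s : Finset Space) (p : Space),
      (∀ x ∈ s, ∀ y ∈ s, x ≠ y → a ≤ ‖x - y‖) → (∀ x ∈ s, ‖x - p‖ ≤ R) → (s.card : ℝ) ≤ (1 + 2 * R / a) ^ 3)
    {a b : ℝ} (ha : 0 < a) (hb : 0 ≤ b) {f₀ : Space → ℝ} (hφ₀ : IsPairProfile b f₀) (hL : 0 < L) (hbL : 2 * b < L)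
    (Ψ : PeriodicTrialState (n + 1) L)
    (hsupp : ∀ X : Config (n + 1), Ψ.ψ X ≠ 0 → ∀ i j : Fin (n + 1), i ≠ j → ∀ m : Fin 3 → ℤ,
      a ≤ ‖X i - X j - latticeVec L m‖)
    (c : ℝ) (t : Space) (Z : Config (n + 1) × Config (n + 1)) :
    ((‖Ψ.ψ Z.1 * Ψ.ψ (Z.2 - fun _ => t)‖₊ : ℝ≥0∞)) ^ 2 *
        (kinetic2 n (fun W => (Real.sin (c * ((∏ j : Fin n, pairFactor L f₀ (W.1 0 - W.2 j.succ)) *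
            ∏ j : Fin n, pairFactor L f₀ (W.2 0 - W.1 j.succ))) : ℂ)) Z +
          kinetic2 n (fun W => (Real.cos (c * ((∏ j : Fin n, pairFactor L f₀ (W.1 0 - W.2 j.succ)) *
            ∏ j : Fin n, pairFactor L f₀ (W.2 0 - W.1 j.succ))) : ℂ)) Z) ≤
      (∑ j : Fin n,
          ((ENNReal.ofReal (c ^ 2) * ENNReal.ofReal ((1 + 2 * b / a) ^ 3 + 1) *
                gradSq (pairFactor L f₀) (Z.1 0 - Z.2 j.succ) +
              ENNReal.ofReal (1 - pairFactor L f₀ (Z.1 0 - Z.2 j.succ) ^ 2)) +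
            (ENNReal.ofReal (c ^ 2) * ENNReal.ofReal ((1 + 2 * b / a) ^ 3 + 1) *
                gradSq (pairFactor L f₀) (Z.2 0 - Z.1 j.succ) +
              ENNReal.ofReal (1 - pairFactor L f₀ (Z.2 0 - Z.1 j.succ) ^ 2)))) *
        ((‖Ψ.ψ Z.1 * Ψ.ψ (Z.2 - fun _ => t)‖₊ : ℝ≥0∞)) ^ 2 := by
  set f : Space → ℝ := pairFactor L f₀ with hf
  have hfC : ContDiff ℝ 1 f := hφ₀.contDiff_pairFactor hL hbL
  by_cases hZ : Ψ.ψ Z.1 * Ψ.ψ (Z.2 - fun _ => t) = 0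
  · simp only [hZ, nnnorm_zero, ENNReal.coe_zero, zero_pow two_ne_zero, zero_mul, mul_zero, le_refl]
  obtain ⟨hX, hY⟩ := mul_ne_zero_iff.1 hZ
  -- `a`-separation of the images of all pairs of either copy
  have hsepX := hsupp Z.1 hX
  have hsepY : ∀ i j : Fin (n + 1), i ≠ j → ∀ m : Fin 3 → ℤ, a ≤ ‖Z.2 i - Z.2 j - latticeVec L m‖ := by
    intro i j hij m
    have h := hsupp _ hY i j hij m
    rwa [Pi.sub_apply, Pi.sub_apply, sub_sub_sub_cancel_right] at h
  -- packing: the active bath particles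
  obtain ⟨SX, hcardX, hSX⟩ := exists_active_finset hPk ha hb L hsepY (Z.1 0)
  obtain ⟨SY, hcardY, hSY⟩ := exists_active_finset hPk ha hb L hsepX (Z.2 0)
  have hdX : ∀ j, j ∉ SX → fderiv ℝ f (Z.1 0 - Z.2 j.succ) = 0 := fun j hj => by
    rw [hf, hφ₀.fderiv_pairFactor hL hbL]
    exact hφ₀.fderiv_eq_zero (hSX j hj).le
  have hdY : ∀ j, j ∉ SY → fderiv ℝ f (Z.2 0 - Z.1 j.succ) = 0 := fun j hj => by
    rw [hf, hφ₀.fderiv_pairFactor hL hbL]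
    exact hφ₀.fderiv_eq_zero (hSY j hj).le
  have hkin := kinetic2_crossCutoff_le hfC (fun y => hφ₀.pairFactor_nonneg y) (fun y => hφ₀.pairFactor_le_one y)
    Z hdX hdY hcardX hcardY
  -- the gradient identity of the partition and bookkeeping
  rw [kinetic2_sin_add_cos (contDiff_crossCutoff hfC) c Z, mul_comm]
  gcongr
  refine (mul_le_mul_right hkin _).trans ?_
  rw [← mul_assoc, Finset.mul_sum]
  exact Finset.sum_le_sum fun j _ => by rw [mul_add]; exact add_le_add le_self_add le_self_add

/-- **The mass deficit density is bounded by the cross weight**: `|Θ cos(cφ)|²`… for `c = π/2`: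
`|Θ cos(πφ/2)|² ≤ W |Θ|²` (Jordan and `1 - ∏² ≤ ∑ (1 - ·²)`, part A; the gradient part of `W` only helps).
[folklore] -/
theorem normSq_mul_cos_le {f : Space → ℝ} (h0 : ∀ y, 0 ≤ f y) (h1 : ∀ y, f y ≤ 1) (κ : Space → ℝ≥0∞) (w : ℂ)
    (Z : Config (n + 1) × Config (n + 1)) :
    ((‖w * (Real.cos (Real.pi / 2 * ((∏ j : Fin n, f (Z.1 0 - Z.2 j.succ)) * ∏ j : Fin n, f (Z.2 0 - Z.1 j.succ))) : ℂ)‖₊ :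
        ℝ≥0∞)) ^ 2 ≤
      (∑ j : Fin n, ((κ (Z.1 0 - Z.2 j.succ) + ENNReal.ofReal (1 - f (Z.1 0 - Z.2 j.succ) ^ 2)) +
          (κ (Z.2 0 - Z.1 j.succ) + ENNReal.ofReal (1 - f (Z.2 0 - Z.1 j.succ) ^ 2)))) * ((‖w‖₊ : ℝ≥0∞)) ^ 2 := by
  refine (ennnorm_sq_mul_cos_le Finset.univ (fun j => h0 _) (fun j => h1 _) (fun j => h0 _) (fun j => h1 _) w).trans ?_
  rw [mul_comm _ (((‖w‖₊ : ℝ≥0∞)) ^ 2), ← Finset.sum_add_distrib]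
  exact mul_le_mul_right (Finset.sum_le_sum fun j _ => add_le_add le_add_self le_add_self) _

end UpperFrameHardCorePointwise

/-! ### The registered helper stub of part C1 -/

/-- Part C1 of `stub_upperFrameHardCore` (helper stub `stub_upperFrameHardCorePointwise`, registered signature): **no
cross interaction on the cut-off test function** — for the cross cut-off built from the periodic factor of
`f₀(y) = θ((|y| - R)/a)` and a profile vanishing beyond `R`, `E2(½)(Θ sin(cφ)) ≤ E2(0)(Θ sin(cφ))`. [folklore] -/
theorem stub_upperFrameHardCorePointwise :
    ∀ (v : ℝ → ℝ≥0∞), Measurable v → ∀ (a R L : ℝ) (n : ℕ), 0 < a → 0 ≤ R → (∀ r : ℝ, R < r → v r = 0) → 0 < L →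
      2 * (R + 2 * a) < L → ∀ (Θ : Config (n + 1) × Config (n + 1) → ℂ), Continuous Θ → ∀ c : ℝ,
      TwoCopyTorus.E2half v n L (fun Z => Θ Z * (Real.sin (c * ((∏ j : Fin n, pairFactor L (fun y : Space =>
      Literature.Analysis.FunctionSpaces.Torus.smoothCutProfile ((‖y‖ - R) / a)) (Z.1 0 - Z.2 j.succ)) * ∏ j :
      Fin n, pairFactor L (fun y : Space => Literature.Analysis.FunctionSpaces.Torus.smoothCutProfile ((‖y‖ - R)
      / a)) (Z.2 0 - Z.1 j.succ))) : ℂ)) ≤ TwoCopyTorus.E2zero v n L (fun Z => Θ Z * (Real.sin (c * ((∏ j : Fin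
      n, pairFactor L (fun y : Space => Literature.Analysis.FunctionSpaces.Torus.smoothCutProfile ((‖y‖ - R) /
      a)) (Z.1 0 - Z.2 j.succ)) * ∏ j : Fin n, pairFactor L (fun y : Space =>
      Literature.Analysis.FunctionSpaces.Torus.smoothCutProfile ((‖y‖ - R) / a)) (Z.2 0 - Z.1 j.succ))) : ℂ)) :=
  fun _ hvm _ _ _ _ ha hR hvR hL hbL _ hΘ c =>
    UpperFrameHardCorePointwise.E2half_le_E2zero_of_cut hvm ha hR hvR hL hbL hΘ c

end Summit.AtomisticToContinuum.BoseEinsteinCondensation.Cruxes.TorusHalfSwapOverlap.Birth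

end
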